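import Literature.AlgebraicGeometry.Frobenioids.ArchimedeanFrobeniusTrivial
import Literature.AlgebraicGeometry.Frobenioids.ArchimedeanMonoInjective
import Literature.AlgebraicGeometry.Frobenioids.ArchimedeanRegionCalculus
import Literature.AlgebraicGeometry.Frobenioids.CircleOpensArcs
import HarnessLib

/-!
# Frobenioids II, Example 3.3 (ii): Frobenius-ample objects of `C` are isotropic — (a) ⟺ (b) ⟺ (c) PROVED

Mochizuki, *The geometry of Frobenioids II: poly-Frobenioids*, Kyushu J. Math. **62** (2008)
401–460, §3, Example 3.3 (ii), author's text p. 28 [cite: MochizukiFrdII2008, Ex 3.3 (ii) p.28]: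
"it follows immediately from Lemma 3.2, (iv), that the following conditions on an object of `C` are
equivalent: (a) the object is isotropic; (b) the object is Frobenius-trivial; (c) the object is
Frobenius-ample" and "every endomorphism of a non-isotropic object of `C` is linear".

PROVED here: an object of `C₀` admitting an endomorphism of Frobenius degree `n ≥ 2` is naively
isotropic (`C0.isNaivelyIsotropic_of_endo` — the Lemma 3.2 (iv) argument "angular regions never
shrink": on angular parts the endomorphism gives `ĉ · B^n ⊆ B` or `⊆ conj(B)`, and an open arc
`B = exp(i(c, d)) ≠ S¹` would then satisfy `n(d − c) ≤ d − c`, by the arc-length monotonicity of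
abc-iut-L1-t7's `CircleOpensArcs`), whence (c) ⇒ (a); with `ArchimedeanFrobeniusTrivial.lean`
((a) ⇒ (b) ⇒ (c)) this DISCHARGES `Ex33ii_isotropic_iff_frobeniusTrivial` and
`Ex33ii_frobeniusTrivial_iff_frobeniusAmple`, and gives the linearity half of
`Ex33ii_endo_of_not_isotropic` (`C.isLinear_endo_of_not_isIsotropic`). Bridge `O_ℂ^× ≃ Circle`:
`toCircleHom`; the conjugation rule `unitPart_galAct_true` is abc-iut-L1-d7's (`ArchimedeanRegionCalculus`).
-/

namespace Literature.AlgebraicGeometry.Frobenioids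

open CategoryTheory Complex
open scoped Pointwise

noncomputable section

namespace ArchFrd

/-! ### Bridge between `O_ℂ^× = normOneSubgroup ℂ ⊆ ℂ^×` and Mathlib's `Circle ⊆ ℂ` -/

/-- `O_ℂ^× → S¹ ⊆ ℂ` (same complex number). [cite: MochizukiFrdII2008, Def 3.1 (ii) p.23] -/
def toCircleHom : normOneSubgroup ℂ →* Circle where
  toFun z := ⟨((z : ℂˣ) : ℂ), mem_sphere_zero_iff_norm.2 ((mem_normOneSubgroup_iff ℂ _).mp z.2)⟩
  map_one' := Circle.ext rfl
  map_mul' z w := Circle.ext (by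
    rw [Circle.coe_mul]
    change (((z * w : normOneSubgroup ℂ) : ℂˣ) : ℂ) = ((z : ℂˣ) : ℂ) * ((w : ℂˣ) : ℂ)
    rw [Subgroup.coe_mul, Units.val_mul])

/-- The value of `toCircleHom`. [cite: MochizukiFrdII2008, Def 3.1 (ii) p.23] -/
@[simp] theorem coe_toCircleHom (z : normOneSubgroup ℂ) : (toCircleHom z : ℂ) = ((z : ℂˣ) : ℂ) := rfl

/-- `toCircleHom (e^{iθ}) = Circle.exp θ`. [cite: MochizukiFrdII2008, Def 3.1 (ii) p.23] -/
theorem toCircleHom_expUnit (θ : ℝ) : toCircleHom (expUnit θ) = Circle.exp θ := Circle.ext rfl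

/-- `toCircleHom` is injective. [cite: MochizukiFrdII2008, Def 3.1 (ii) p.23] -/
theorem toCircleHom_injective : Function.Injective toCircleHom := fun z w h => by
  apply Subtype.ext; apply Units.ext
  exact congrArg (fun c : Circle => (c : ℂ)) h

/-- The inverse map `S¹ → O_ℂ^×`. [cite: MochizukiFrdII2008, Def 3.1 (ii) p.23] -/
def fromCircle (w : Circle) : normOneSubgroup ℂ :=
  ⟨Circle.toUnits w, by rw [mem_normOneSubgroup_iff]; exact w.norm_coe⟩

/-- `toCircleHom ∘ fromCircle = id`. [cite: MochizukiFrdII2008, Def 3.1 (ii) p.23] -/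
@[simp] theorem toCircleHom_fromCircle (w : Circle) : toCircleHom (fromCircle w) = w := Circle.ext rfl

/-- `fromCircle ∘ toCircleHom = id`. [cite: MochizukiFrdII2008, Def 3.1 (ii) p.23] -/
@[simp] theorem fromCircle_toCircleHom (z : normOneSubgroup ℂ) : fromCircle (toCircleHom z) = z := by
  apply Subtype.ext; apply Units.ext; rfl

/-- `toCircleHom` is continuous. [cite: MochizukiFrdII2008, Def 3.1 (iii) p.24] -/
theorem continuous_toCircleHom : Continuous toCircleHom :=
  Continuous.subtype_mk (Units.continuous_val.comp continuous_subtype_val) _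

/-- `fromCircle` is continuous. [cite: MochizukiFrdII2008, Def 3.1 (iii) p.24] -/
theorem continuous_fromCircle : Continuous fromCircle := by
  apply Continuous.subtype_mk
  rw [Units.continuous_iff]
  constructor
  · exact continuous_subtype_val
  · have h : (fun w : Circle => ((Circle.toUnits w)⁻¹ : ℂˣ).val) = fun w => ((w⁻¹ : Circle) : ℂ) := by
      funext w
      rw [Units.val_inv_eq_inv_val, Circle.toUnits_apply, Units.val_mk0, Circle.coe_inv]
    rw [h]
    exact continuous_subtype_val.comp continuous_inv

/-- Images under `toCircleHom` are preimages under `fromCircle`. [cite: MochizukiFrdII2008, Def 3.1 (iii) p.24] -/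
theorem image_toCircleHom_eq_preimage (B : Set (normOneSubgroup ℂ)) :
    toCircleHom '' B = fromCircle ⁻¹' B := by
  ext w
  constructor
  · rintro ⟨z, hz, rfl⟩
    change fromCircle (toCircleHom z) ∈ B
    rwa [fromCircle_toCircleHom]
  · intro hw
    exact ⟨fromCircle w, hw, toCircleHom_fromCircle w⟩

/-- The angular part of an angular region, moved to `Circle`, is open. [cite: MochizukiFrdII2008, Def 3.1 (iii) p.24] -/
theorem isOpen_image_dir (A : AngularRegion ℂ) : IsOpen (toCircleHom '' A.dir) := by
  rw [image_toCircleHom_eq_preimage]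
  exact A.isOpen_dir.preimage continuous_fromCircle

/-- … and connected (`O_ℂ^×` has one connected component). [cite: MochizukiFrdII2008, Def 3.1 (iii) p.24] -/
theorem isConnected_image_dir (A : AngularRegion ℂ) : IsConnected (toCircleHom '' A.dir) := by
  have h := A.isConnected_inter 1
  rw [connectedComponent_eq_univ' 1, Set.inter_univ] at h
  exact h.image _ continuous_toCircleHom.continuousOn

/-- … and proper when the region is not isotropic. [cite: MochizukiFrdII2008, Def 3.1 (iii) p.24] -/
theorem image_dir_ne_univ (A : AngularRegion ℂ) (hA : ¬ A.IsIsotropic) :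
    toCircleHom '' A.dir ≠ Set.univ := by
  intro h
  apply hA
  refine Set.eq_univ_of_forall fun z => ?_
  have hz : toCircleHom z ∈ toCircleHom '' A.dir := by rw [h]; trivial
  obtain ⟨z', hz', e⟩ := hz
  rwa [← toCircleHom_injective e]

/-- `Circle.exp (n y) = (Circle.exp y)^n`. [cite: MochizukiFrdII2008, Lem 3.2 p.25] -/
theorem circleExp_nat_mul (n : ℕ) (y : ℝ) : Circle.exp ((n : ℝ) * y) = Circle.exp y ^ n := by
  induction n with
  | zero => rw [Nat.cast_zero, zero_mul, Circle.exp_zero, pow_zero]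
  | succ k ih => rw [Nat.cast_succ, add_mul, one_mul, Circle.exp_add, ih, pow_succ]

/-! ### An endomorphism of degree `≥ 2` forces isotropy (Lemma 3.2 (iv)) -/

namespace C0

/-- **"Angular regions never shrink"**: an object of `C₀` with an endomorphism of Frobenius degree
`n ≥ 2` is naively isotropic. [cite: MochizukiFrdII2008, Ex 3.3 (ii) p.28] -/
theorem isNaivelyIsotropic_of_endo {X : C0} (φ : X ⟶ X) (hn : 2 ≤ (degFr φ : ℕ)) :
    X.IsNaivelyIsotropic := by
  by_contra hB
  -- the angular part as an open arc `exp(i(c, d))` of `Circle`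
  obtain ⟨c, d, hcd, hlen, hB'⟩ := CircleOpens.exists_eq_exp_image_Ioo (isConnected_image_dir X.region)
    (isOpen_image_dir X.region) (image_dir_ne_univ X.region hB)
  set n : ℕ := (degFr φ : ℕ) with hndef
  set σ := D0.Hom.twists (Base φ) with hσ
  set ch : normOneSubgroup ℂ := unitPart ℂ (scalar φ) with hch
  -- KEY: for every direction `z ∈ B`, `σ(ĉ · zⁿ) ∈ B`
  have key : ∀ z : normOneSubgroup ℂ, z ∈ X.region.dir →
      unitPart ℂ (D0.galAct σ (scalar φ * ((z : ℂˣ) * ofPosReal ℂ X.region.tip) ^ n)) ∈ X.region.dir := by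
    intro z hz
    have ha : (z : ℂˣ) * ofPosReal ℂ X.region.tip ∈ X.region.carrier := by
      refine ⟨?_, ?_⟩
      · rw [unitPart_coe_mul_ofPosReal]; exact hz
      · have h2 : absHom ℂ ((z : ℂˣ) * ofPosReal ℂ X.region.tip) = X.region.tip :=
          (Prod.ext_iff.mp ((unitDecomposition ℂ).symm_apply_apply (z, X.region.tip))).2
        exact h2.le
    obtain ⟨p, hp, hpe⟩ := φ.mapsTo (Set.smul_mem_smul_set (Set.pow_mem_pow ha))
    have hp' : p = D0.galAct σ (scalar φ * ((z : ℂˣ) * ofPosReal ℂ X.region.tip) ^ n) := by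
      rw [← smul_eq_mul, ← hpe]; exact (D0.galAct_galAct _ _).symm
    rw [← hp']
    exact hp.1
  -- the direction of `ĉ zⁿ` and its image in `Circle`
  have hdir : ∀ z : normOneSubgroup ℂ,
      unitPart ℂ (scalar φ * ((z : ℂˣ) * ofPosReal ℂ X.region.tip) ^ n) = ch * z ^ n := by
    intro z
    rw [unitPart_mul, ← hch]
    congr 1
    induction n with
    | zero =>
      rw [pow_zero, pow_zero]
      have h := unitPart_coe_normOne (1 : normOneSubgroup ℂ)
      rwa [OneMemClass.coe_one] at h
    | succ k ih => rw [pow_succ, pow_succ, unitPart_mul, ih, unitPart_coe_mul_ofPosReal]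
  obtain ⟨θ, hθ⟩ : ∃ θ : ℝ, toCircleHom ch = Circle.exp θ :=
    ⟨arg ((ch : ℂˣ) : ℂ), by rw [← toCircleHom_expUnit, expUnit_arg]⟩
  have hn' : (2 : ℝ) ≤ n := by exact_mod_cast hn
  have hnpos : (0 : ℝ) < n := by linarith
  -- points of the arc `exp(i(θ + n c, θ + n d))` come from `B`
  have hpt : ∀ x ∈ Set.Ioo (θ + n * c) (θ + n * d), ∃ z ∈ X.region.dir,
      Circle.exp x = toCircleHom (ch * z ^ n) := by
    intro x hx
    set y := (x - θ) / n with hy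
    have hy1 : c < y := by rw [hy, lt_div_iff₀ hnpos]; linarith [hx.1]
    have hy2 : y < d := by rw [hy, div_lt_iff₀ hnpos]; linarith [hx.2]
    have hmem : Circle.exp y ∈ toCircleHom '' X.region.dir := by rw [hB']; exact ⟨y, ⟨hy1, hy2⟩, rfl⟩
    obtain ⟨z, hz, hzexp⟩ := hmem
    refine ⟨z, hz, ?_⟩
    rw [map_mul, map_pow, hzexp, hθ, ← circleExp_nat_mul, ← Circle.exp_add]
    congr 1
    rw [hy]; field_simp; ring
  -- conclude by arc length, according to the twist `σ`
  cases hσv : σ with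
  | false =>
    have hsub : Circle.exp '' Set.Ioo (θ + n * c) (θ + n * d) ⊆ Circle.exp '' Set.Ioo c d := by
      rintro _ ⟨x, hx, rfl⟩
      obtain ⟨z, hz, hzx⟩ := hpt x hx
      have := key z hz
      rw [hσv, D0.galAct_false, hdir] at this
      rw [hzx, ← hB']
      exact ⟨_, this, rfl⟩
    have := CircleOpens.sub_le_sub_of_exp_image_Ioo_subset (by nlinarith) hlen hsub
    nlinarith
  | true =>
    have hsub : Circle.exp '' Set.Ioo (θ + n * c) (θ + n * d) ⊆ Circle.exp '' Set.Ioo (-d) (-c) := by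
      rintro _ ⟨x, hx, rfl⟩
      obtain ⟨z, hz, hzx⟩ := hpt x hx
      have hk := key z hz
      rw [hσv, unitPart_galAct_true, hdir] at hk
      have hmem : toCircleHom ((ch * z ^ n)⁻¹) ∈ toCircleHom '' X.region.dir := ⟨_, hk, rfl⟩
      rw [hB'] at hmem
      obtain ⟨y, hy, hyexp⟩ := hmem
      refine ⟨-y, ⟨by linarith [hy.2], by linarith [hy.1]⟩, ?_⟩
      rw [Circle.exp_neg, hyexp, map_inv, inv_inv, hzx]
    have := CircleOpens.sub_le_sub_of_exp_image_Ioo_subset (by nlinarith) (by linarith) hsub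
    nlinarith

end C0

universe v u

variable {D : Type u} [Category.{v} D] (π : D ⥤ D0)

/-- **Example 3.3 (ii)**: every endomorphism of a non-isotropic object of `C` is LINEAR
(the linearity half of `Ex33ii_endo_of_not_isotropic`). [cite: MochizukiFrdII2008, Ex 3.3 (ii) p.28] -/
theorem C.isLinear_endo_of_not_isIsotropic (X : C π) (φ : X ⟶ X)
    (hX : ¬ PreFrobenioid.IsIsotropic (C.toElem π) X) : PreFrobenioid.IsLinear (C.toElem π) φ := by
  by_contra hlin
  apply hX
  refine (Ex33ii_isotropic_iff_holds π X).mpr (C0.isNaivelyIsotropic_of_endo φ.fst ?_)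
  have h1 : (C0.degFr φ.fst : ℕ) ≠ 1 := fun h => hlin (PNat.coe_inj.mp h)
  have h2 := (C0.degFr φ.fst).pos
  omega

/-- **Example 3.3 (ii), (c) ⇒ (a)**: a Frobenius-ample object of `C` is isotropic.
[cite: MochizukiFrdII2008, Ex 3.3 (ii) p.28] -/
theorem isIsotropic_of_isFrobeniusAmple (X : C π)
    (h : PreFrobenioid.IsFrobeniusAmple (C.toElem π) X) : PreFrobenioid.IsIsotropic (C.toElem π) X := by
  obtain ⟨φ, hφ⟩ := h 2
  refine (Ex33ii_isotropic_iff_holds π X).mpr (C0.isNaivelyIsotropic_of_endo φ.fst ?_)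
  have : C0.degFr φ.fst = 2 := hφ
  rw [this]; rfl

/-- **Example 3.3 (ii), (a) ⟺ (b)** — DISCHARGES `Ex33ii_isotropic_iff_frobeniusTrivial`.
[cite: MochizukiFrdII2008, Ex 3.3 (ii) p.28] -/
theorem Ex33ii_isotropic_iff_frobeniusTrivial_holds : Ex33ii_isotropic_iff_frobeniusTrivial π :=
  fun X => ⟨isFrobeniusTrivial_of_isIsotropic π X, fun h =>
    isIsotropic_of_isFrobeniusAmple π X (isFrobeniusAmple_of_isFrobeniusTrivial π h)⟩

/-- **Example 3.3 (ii), (b) ⟺ (c)** — DISCHARGES `Ex33ii_frobeniusTrivial_iff_frobeniusAmple`.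
[cite: MochizukiFrdII2008, Ex 3.3 (ii) p.28] -/
theorem Ex33ii_frobeniusTrivial_iff_frobeniusAmple_holds :
    Ex33ii_frobeniusTrivial_iff_frobeniusAmple π :=
  fun X => ⟨isFrobeniusAmple_of_isFrobeniusTrivial π, fun h =>
    isFrobeniusTrivial_of_isIsotropic π X (isIsotropic_of_isFrobeniusAmple π X h)⟩

end ArchFrd

end

end Literature.AlgebraicGeometry.Frobenioids
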